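import Summits.ABC.IUTFork.Cor312PinnedHonestInflation
import Summits.ABC.IUTFork.Cor312PinnedCountermodel
import Summits.ABC.IUTFork.Cor312PinnedFrameFlip
import Summits.ABC.IUTFork.Cor312PinnedCountermodelLink
import HarnessLib

/-!
# [IUTchIII] Cor. 3.12 — the hull-INFLATION identity at the two pinned models of record (non-vacuity, both tines)

Proof-only record file (D-0012; abc-iut cell, wave 4, seat abc-iut-w4-d103 gen 3, PR-3 lineage). Companion of
`Cor312PinnedHonestInflation` (p425829: on every honest pin-respecting setting the typed Corollary is EXACTLY «total hull inflation
≥ c(l⋇)·|log(q)|», `c(l⋇) = (2l⋇+5)(l⋇−1)/6`). TAKES NO SIDE on [IUTchIII] Cor. 3.12; NO definition, NO `Prop` fact; nothing frozen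
edited. It instantiates EVERY hypothesis of `statement_iff_hullInflation` (ThetaFinite, label-independent q-volume, the Θ-pin (pΘ),
Thm. 3.11 (ii)(b) `KummerB`, honest `j²`-scaling; label-independence is abc-iut-w5-d155's `pinnedSetting_qLocal_indep`, imported) at the two pin-respecting models of record over abc-iut-w5-d247's contentful naive
`p`-adic situation `naiveFull p` (`l⋇ = 2`, so `c(2) = 3/2`, `|log(q)| = log p`), which share ALL Θ-side data, the operator
`orbitRegion` and the q-datum `qDatum` and differ ONLY in the hull frame:
* PR-2's `PinnedWitness.pinnedSetting p` (abc-iut-w4-d101, p418585/p419720; frame = all balls): hull `ⁿ˒°𝒰_j = B_{j²}` = the Θ-image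
  ⇒ inflation `0` in every packet ⇒ budget `(3/2)·log p > 0` unmet ⇒ `¬ Statement` — RE-DERIVED here through the identity
  (`pinned_not_statement_via_inflation`; agrees with `pinnedSetting_not_statement`);
* this lineage's `flipSetting p` (p420622; frame = {B_0, B_1}): hull `= B_1` ⇒ inflation `(j² − 1)·log p` ⇒ total `((0 + 3)/2)·log p
  = (3/2)·log p` = EXACTLY the budget ⇒ `Statement` — re-derived through the identity (`flip_statement_via_inflation`; agrees with
  `flip_statement`): the inflated model of record sits ON the barrier.
So the identity is contentful on both sides and its sign conventions are the tree's. Sources: [IUTchIII] kurims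
[corpus:book:anonnd-inter-universal-teichmuller-theory-iii] p. 173 l. 41 – p. 174 l. 19 (statement), p. 183 l. 43 – p. 184 l. 29
((xi-e)/(xi-f)); [IUTchIV] Thm. 1.10 Step (v) [corpus:book:anonnd-inter-universal-teichmuller-theory-iv p. 27 l. 57 – p. 28 l. 5].
[claim: Mochizuki2012, status: disputed] for the quoted objects; interface-level toy carriers (one place, `l⋇ = 2`), NOT models of
initial Θ-data; typed ≠ proved.
-/

noncomputable section

open Set

namespace Summit.ABC.IUTFork.Cor312Vol.PinnedHonest

open Thm311 Cor312 Cor312.Checks Cor312.IdentifiedNonVacuity Cor312Vol Cor312Vol.NaiveWitness Cor312Vol.PinnedWitness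
open Literature.IUT.LogThetaLattice

variable (p : ℕ) [hp : Fact p.Prime]

/-! ## 1. The shared honest data: the hypotheses of the identity HOLD at the pinned models -/

omit hp in
/-- `l⋇ = 2` for the toy index, as a real number. [folklore] -/
private theorem lstar_real : (toyIndex.lstar : ℝ) = 2 := by
  exact_mod_cast (show toyIndex.lstar = 2 by decide)

/-- The q-volume of PR-2's pinned model at every label of `𝔽_l^⋇` is `−log p` (the ball `B_1 = q·𝒪`). [folklore] -/
theorem pinned_qLocal_eq (i : Fin toyIndex.lstar) (vQ : toyIndex.VQ) :
    (pinnedSetting p).qLocal (Setting.labelSucc i) vQ = -Real.log p := by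
  unfold Setting.qLocal
  rw [pinnedSetting_qRegion_of_ne_zero p (Setting.labelSucc_ne_zero i)]
  show pVol p _ vQ (pBall p _ vQ 1) = _
  rw [pVol_pBall]
  simp

-- Label-independence of the q-volume (hypothesis `hindep`) is abc-iut-w5-d155's
-- `PinnedLink.Naive.pinnedSetting_qLocal_indep` (Cor312PinnedCountermodelLink, p421960) — imported, not restated.

omit hp in
/-- The exponent `j²` at the label `j = i + 1`, as a natural-number cast. [folklore] -/
theorem jsq_labelSucc (i : Fin toyIndex.lstar) :
    (jsq (Setting.labelSucc i) : ℝ) = ((((i : ℕ) + 1 : ℕ) : ℝ)) ^ 2 := by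
  unfold jsq Setting.labelSucc
  push_cast
  simp [Fin.val_succ]

/-- **HONEST `j²`-SCALING HOLDS** (hypothesis `hscaled` of p418630 / p425829): the `orbitRegion` of the column's Θ-splitting monoid at
label `j = i+1` is `B_{j²}`, of log-volume `−j²·log p = j²·(q-volume)`. [folklore] -/
theorem pinned_hscaled (i : Fin toyIndex.lstar) (vQ : toyIndex.VQ) :
    ((naiveFull p).toLatticeSituation.D (pinnedSetting p).n).logvol _ vQ
        (orbitRegion p ((naiveFull p).toLatticeSituation.D (pinnedSetting p).n).Ψ (Setting.labelSucc i) vQ) =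
      (((i : ℕ) + 1 : ℕ) : ℝ) ^ 2 * (pinnedSetting p).qLocal (Setting.labelSucc i) vQ := by
  have hΨ : ((naiveFull p).toLatticeSituation.D (pinnedSetting p).n).Ψ = fun v _ => Psi p v := rfl
  rw [hΨ, orbitRegion_Psi, pinned_qLocal_eq]
  show pVol p _ vQ (pBall p _ vQ (jsq (Setting.labelSucc i))) = _
  rw [pVol_pBall, jsq_labelSucc]
  ring

omit hp in
/-- Thm. 3.11 (ii)(b) `KummerB` for the column of the pinned model (abc-iut-w5-d247's `naive_partII`). [folklore] -/
theorem pinned_kummerB :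
    ((naiveFull p).toLatticeSituation.col (pinnedSetting p).n).KummerB
      ((naiveFull p).toLatticeSituation.D (pinnedSetting p).n) :=
  (naive_partII p (pinnedSetting p).n).2.1

/-! ## 2. PR-2's inflation-free model: zero inflation, budget unmet, `¬ Statement` through the identity -/

omit hp in
/-- The packet hull of PR-2's model at label `j` is the Θ-image `B_{j²}` itself (frame = all balls; the possible images are the
singleton `{B_{j²}}`). [folklore] -/
theorem pinned_thetaHull_eq (j : toyIndex.Label) (vQ : toyIndex.VQ) :
    (pinnedSetting p).thetaHull j vQ = pBall p j vQ (jsq j) := by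
  show (pFrame p j vQ).hull (⋃₀ (pinnedSetting p).possibleImages j vQ) = _
  rw [pinnedSetting_possibleImages, Set.sUnion_singleton, pFrame_hull_pBall]

omit hp in
/-- **ZERO INFLATION** in every packet of PR-2's model: hull volume = Θ-image volume (the column's data `(naiveFull p).D n` is
abc-iut-w5-d247's `naiveData p`, log-volume `pVol`). [folklore] -/
theorem pinned_inflation_eq_zero (i : Fin toyIndex.lstar) (vQ : toyIndex.VQ) :
    (naiveData p).logvol (Setting.labelSucc i) vQ ((pinnedSetting p).thetaHull (Setting.labelSucc i) vQ) -
      (naiveData p).logvol (Setting.labelSucc i) vQ ((pinnedSetting p).thetaRegion3 (Setting.labelSucc i) vQ) = 0 := by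
  rw [pinned_thetaHull_eq, pinnedSetting_thetaRegion3, sub_self]

/-- **The identity at PR-2's model**: `Statement ↔ (3/2)·log p ≤ 0` (budget `c(2)·|log(q)| = (3/2)·log p`, total inflation `0`).
[folklore] -/
theorem pinned_statement_iff_via_inflation : (pinnedSetting p).Statement ↔ (3 : ℝ) / 2 * Real.log p ≤ 0 := by
  rw [statement_iff_hullInflation_closedForm (naiveFull p).toLatticeSituation (pinnedSetting p) (orbitRegion p)
    (pinnedSetting_bridgeHyps p).finite (PinnedLink.Naive.pinnedSetting_qLocal_indep p) (pinned_kummerB p) (pinnedSetting_thetaPinned p)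
    (pinned_hscaled p)]
  simp only [pinned_inflation_eq_zero, finsum_zero]
  rw [processionNormalized_const (show 0 < toyIndex.lstar by decide), pinnedSetting_negLogQ, lstar_real]
  constructor <;> intro h <;> linarith

/-- **`¬ Statement` RE-DERIVED through the inflation identity** (agrees with PR-2's `pinnedSetting_not_statement`): no inflation, positive
budget. [folklore] -/
theorem pinned_not_statement_via_inflation : ¬ (pinnedSetting p).Statement := by
  rw [pinned_statement_iff_via_inflation]
  have := log_p_pos p
  intro h
  linarith

/-! ## 3. The inflated model of record `flipSetting`: inflation `(j² − 1)·log p`, budget met EXACTLY, `Statement` through the identity -/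

/-- The flipped model has the SAME q-volumes, column, pins and Θ-data (only the frame differs). [folklore] -/
theorem flip_qLocal_eq (i : Fin toyIndex.lstar) (vQ : toyIndex.VQ) :
    (flipSetting p).qLocal (Setting.labelSucc i) vQ = -Real.log p :=
  pinned_qLocal_eq p i vQ

/-- **INFLATION `(j² − 1)·log p`** in the packet at label `j = i+1` of the flipped model: hull `B_1` over Θ-image `B_{j²}`. [folklore] -/
theorem flip_inflation_eq (i : Fin toyIndex.lstar) (vQ : toyIndex.VQ) :
    (naiveData p).logvol (Setting.labelSucc i) vQ ((flipSetting p).thetaHull (Setting.labelSucc i) vQ) -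
      (naiveData p).logvol (Setting.labelSucc i) vQ ((flipSetting p).thetaRegion3 (Setting.labelSucc i) vQ) =
      ((((i : ℕ) + 1 : ℕ) : ℝ) ^ 2 - 1) * Real.log p := by
  rw [flip_thetaHull, flip_thetaRegion3]
  show pVol p _ vQ (pBall p _ vQ 1) - pVol p _ vQ (pBall p _ vQ (jsq (Setting.labelSucc i))) = _
  rw [pVol_pBall, pVol_pBall, jsq_labelSucc]
  push_cast
  ring

/-- **TOTAL INFLATION = `(3/2)·log p`** (`((1−1) + (4−1))/2 · log p`): the flipped model sits EXACTLY on the barrier `c(2)·|log(q)|`.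
[folklore] -/
theorem flip_totalInflation_eq :
    processionNormalized (fun i : Fin toyIndex.lstar =>
      ∑ᶠ vQ : toyIndex.VQ,
        (((naiveFull p).toLatticeSituation.D (flipSetting p).n).logvol _ vQ
            ((flipSetting p).thetaHull (Setting.labelSucc i) vQ) -
          ((naiveFull p).toLatticeSituation.D (flipSetting p).n).logvol _ vQ
            ((flipSetting p).thetaRegion3 (Setting.labelSucc i) vQ))) = (3 : ℝ) / 2 * Real.log p := by
  simp only [finsum_unique, flip_inflation_eq]
  unfold processionNormalized
  rw [lstar_real]
  show (∑ i : Fin 2, ((((i : ℕ) + 1 : ℕ) : ℝ) ^ 2 - 1) * Real.log p) / 2 = _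
  rw [Fin.sum_univ_two]
  norm_num
  ring

/-- **The identity at the flipped model**: `Statement ↔ (3/2)·log p ≤ (3/2)·log p`. [folklore] -/
theorem flip_statement_iff_via_inflation :
    (flipSetting p).Statement ↔ (3 : ℝ) / 2 * Real.log p ≤ (3 : ℝ) / 2 * Real.log p := by
  rw [statement_iff_hullInflation_closedForm (naiveFull p).toLatticeSituation (flipSetting p) (orbitRegion p)
    (flip_thetaFinite p) (PinnedLink.Naive.pinnedSetting_qLocal_indep p) (pinned_kummerB p) (flip_pinnedRegions3 p).1.1 (pinned_hscaled p),
    flip_totalInflation_eq, flip_negLogQ, lstar_real]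
  constructor <;> intro h <;> linarith

/-- **`Statement` RE-DERIVED through the inflation identity** at the flipped model (agrees with `flip_statement`, p420622): the budget
is met with equality. [folklore] -/
theorem flip_statement_via_inflation : (flipSetting p).Statement :=
  (flip_statement_iff_via_inflation p).2 le_rfl

/-! ## 4. Packaged non-vacuity of the identity, both tines -/

/-- **NON-VACUITY OF THE INFLATION IDENTITY, BOTH TINES** (at `p = 2`): two pin-respecting settings over the SAME contentful naive
situation, the same honest operator `ρ = orbitRegion` and q-datum `qK = qDatum`, both satisfying EVERY hypothesis of
`statement_iff_hullInflation` (ThetaFinite, label-independent q-volume, `KummerB`, the Θ-pin, honest `j²`-scaling) and `PinnedRegions3`,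
`|log(q)| > 0`: at the first the total hull inflation is `0` and the typed Corollary FAILS; at the second it is `(3/2)·log 2 =
c(2)·|log(q)|` and the typed Corollary HOLDS. Interface-level; no judgement on print. [folklore] -/
theorem inflation_identity_nonvacuous :
    ∃ (F : FullSituation toyIndex) (P₁ P₂ : Setting F.toLatticeSituation.toSituation)
      (ρ : (∀ v : toyIndex.V, v ∈ toyIndex.Vbad → Set (F.L.StarPacket v)) →
        ∀ (j : toyIndex.Label) (vQ : toyIndex.VQ), Set (F.L.Packet j vQ))
      (qK : ∀ v : toyIndex.V, v ∈ toyIndex.Vbad → Set (F.L.StarPacket v)),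
      F.Statement ∧ P₁.n = P₂.n ∧
      PinnedRegions3 F.toLatticeSituation P₁ ρ qK ∧ PinnedRegions3 F.toLatticeSituation P₂ ρ qK ∧
      P₁.AbsLogQPos ∧ P₂.AbsLogQPos ∧ P₁.ThetaFinite ∧ P₂.ThetaFinite ∧
      (F.toLatticeSituation.col P₁.n).KummerB (F.toLatticeSituation.D P₁.n) ∧
      (∀ (i : Fin toyIndex.lstar) (vQ : toyIndex.VQ),
        (F.toLatticeSituation.D P₁.n).logvol _ vQ (ρ (F.toLatticeSituation.D P₁.n).Ψ (Setting.labelSucc i) vQ) =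
          (((i : ℕ) + 1 : ℕ) : ℝ) ^ 2 * P₁.qLocal (Setting.labelSucc i) vQ) ∧
      (∀ (i : Fin toyIndex.lstar) (vQ : toyIndex.VQ),
        (F.toLatticeSituation.D P₁.n).logvol _ vQ (P₁.thetaHull (Setting.labelSucc i) vQ) -
          (F.toLatticeSituation.D P₁.n).logvol _ vQ (P₁.thetaRegion3 (Setting.labelSucc i) vQ) = 0) ∧
      ¬ P₁.Statement ∧
      processionNormalized (fun i : Fin toyIndex.lstar => ∑ᶠ vQ : toyIndex.VQ,
        ((F.toLatticeSituation.D P₂.n).logvol _ vQ (P₂.thetaHull (Setting.labelSucc i) vQ) -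
          (F.toLatticeSituation.D P₂.n).logvol _ vQ (P₂.thetaRegion3 (Setting.labelSucc i) vQ))) =
        (3 : ℝ) / 2 * Real.log 2 ∧
      P₂.Statement := by
  haveI : Fact (Nat.Prime 2) := ⟨Nat.prime_two⟩
  exact ⟨naiveFull 2, pinnedSetting 2, flipSetting 2, orbitRegion 2, qDatum 2, naiveFull_statement 2, rfl,
    pinnedSetting_pinnedRegions3 2, flip_pinnedRegions3 2, pinnedSetting_absLogQPos 2, flip_absLogQPos 2,
    (pinnedSetting_bridgeHyps 2).finite, flip_thetaFinite 2, pinned_kummerB 2, pinned_hscaled 2,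
    pinned_inflation_eq_zero 2, pinned_not_statement_via_inflation 2, flip_totalInflation_eq 2,
    flip_statement_via_inflation 2⟩

end Summit.ABC.IUTFork.Cor312Vol.PinnedHonest

end
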